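import Mathlib.Analysis.SpecialFunctions.Log.Basic
import Literature.Analysis.Complex.ConformalRadius
import HarnessLib

/-!
# Conformal radius deficit of a boundary perturbation, by the Schwarz lemma alone (proofs only)

Topic `Analysis/Complex`; theorems only, a sequel of `ConformalRadius.lean` (the extremal
conformal radius `Literature.Analysis.Complex.conformalRadius K` about `0` of the component of
`0` in `𝔻 ∖ K`: the supremum of `|φ'(0)|` over univalent `φ : 𝔻 → 𝔻 ∖ K`, `φ(0) = 0`).

In the proof of Lemma 2.3 of Lawler–Schramm–Werner, *One-arm exponent for critical 2D
percolation*, Electron. J. Probab. **7** (2002), paper no. 2 (p. 7), the growth of the hull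
`Q(θ) ↦ Q(2π) = Q(θ) ∪ Q'` by a set `Q'` within distance `r` of the boundary point `1` costs
`min{log 𝔯(θ) - log 𝔯(2π), 1} ≤ c (diam Q')²`, through the harmonic-measure estimates
(2.15)–(2.16). The tree's harmonic-measure-free substitute
(`ConformalRadiusKoebeDeficit.lean`, Koebe distortion) has exponent `1/2` and a factor
`𝔯(K)^{-1/2}`. This file records the elementary LINEAR bound, which needs nothing but the
Schwarz lemma: if `φ` is admissible for `K` then `|φ(w)| ≤ |w|`, so for `|w| < 1 - r` the
point `φ(w)` stays at distance `> r` from every `ζ` with `|ζ| ≥ 1`; hence `z ↦ φ((1 - r) z)`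
is admissible for `K ∪ B̄(ζ, r)`, with derivative `(1 - r) φ'(0)` at `0`:

* `IsUnivalentInto.comp_mul_of_subset_closedBall` — the shrunk map is admissible for `K ∪ K'`
  whenever `K' ⊆ B̄(ζ, r)`, `|ζ| ≥ 1`, `0 < r < 1`;
* `one_sub_mul_conformalRadius_le_union` — **`(1 - r) 𝔯(K) ≤ 𝔯(K ∪ K')`** for `|ζ| ≥ 1`,
  `r ≥ 0`, `K' ⊆ B̄(ζ, r)` (no lower bound on `𝔯(K)`, no connectedness of `K'`);
* `log_conformalRadius_sub_log_union_le_two_mul` — `log 𝔯(K) - log 𝔯(K ∪ K') ≤ 2r` for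
  `r ≤ 1/2` and `𝔯(K) > 0` (`-log(1 - r) ≤ r/(1 - r) ≤ 2r`);
  `min_log_conformalRadius_sub_log_union_le_two_mul` — `min{log 𝔯(K) - log 𝔯(K ∪ K'), 1} ≤ 2r`
  for all `r ≥ 0`;
* `conformalRadius_deficit_of_subset_union` — the LSW shape: for `K ⊆ K₂ ⊆ K ∪ B̄(ζ, r)`,
  `(1 - r) 𝔯(K) ≤ 𝔯(K₂) ≤ 𝔯(K)` and, if `𝔯(K) > 0`, `min{log 𝔯(K) - log 𝔯(K₂), 1} ≤ 2r`.

With a deficit linear in `r`, the window estimate of LSW's Lemma 2.3 to the order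
`o((2π - θ)^{1/3})` asked by the identification theorem of the tree
(`lswHit_two_pi_eq_measureReal_of_renewal`, `OneArmTraceIdentification.lean`) only needs a tail
`P[Q' ⊄ B̄(1, r)] ≤ c ((2π - θ)/r)^γ` with `γ > 1/2` — so the half-plane TWO-arm bound
(exponent `1`, `Nolin2008_halfPlane_twoArm_holds`) suffices in place of the three-arm bound
(2.13). No new definitions, no named facts.

## References

* G. F. Lawler, O. Schramm, W. Werner, *One-arm exponent for critical 2D percolation*, Electron.
  J. Probab. 7 (2002), no. 2, proof of Lemma 2.3, (2.15)–(2.16) (p. 7) [LawlerSchrammWernerEJP2002].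
* G. F. Lawler, *Conformally invariant processes in the plane*, AMS (2005), §3.2, Lemma 2.1
  (Schwarz) [Lawler2008].

## Mathlib / tree

Mathlib: `Complex.norm_le_norm_of_mapsTo_ball` (Schwarz lemma `|f z| ≤ |z|`),
`Real.log_le_sub_one_of_pos`, `Real.add_pow_le_pow_mul_pow_of_sq_le_sq`-free elementary
inequalities. Tree: `IsUnivalentInto`, `conformalRadius_le`, `conformalRadius_mono`,
`conformalRadius_nonneg`, `IsUnivalentInto.norm_deriv_le_conformalRadius` (`ConformalRadius`).
-/

noncomputable section

open Metric Set Filter Topology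

namespace Literature.Analysis.Complex

variable {K K' K₂ : Set ℂ} {φ : ℂ → ℂ} {ζ : ℂ} {r : ℝ}

/-- **Schwarz for admissible maps, pointwise**: `|φ(w)| ≤ |w|` on `𝔻`. [cite: Lawler2008, §3.2 Lemma 2.1] -/
theorem IsUnivalentInto.norm_le_norm (h : IsUnivalentInto K φ) {w : ℂ} (hw : ‖w‖ < 1) :
    ‖φ w‖ ≤ ‖w‖ :=
  Complex.norm_le_norm_of_mapsTo_ball h.differentiableOn
    (fun _ hz ↦ ball_subset_closedBall (h.mapsTo_ball hz)) h.map_zero hw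

/-- **The shrunk map avoids a boundary disc.** If `φ` is admissible for `K`, `|ζ| ≥ 1` and
`K' ⊆ B̄(ζ, r)` with `0 < r < 1`, then `z ↦ φ((1 - r) z)` is admissible for `K ∪ K'`: for
`|z| < 1`, `|φ((1 - r) z)| ≤ (1 - r)|z| < 1 - r` (Schwarz), so `|φ((1 - r) z) - ζ| > r`.
[cite: LawlerSchrammWernerEJP2002, proof of Lemma 2.3 (p. 7)] -/
theorem IsUnivalentInto.comp_mul_of_subset_closedBall (h : IsUnivalentInto K φ) (hζ : 1 ≤ ‖ζ‖)
    (hr0 : 0 < r) (hr1 : r < 1) (hK' : K' ⊆ closedBall ζ r) :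
    IsUnivalentInto (K ∪ K') fun z => φ (((1 - r : ℝ) : ℂ) * z) := by
  have hs0 : (0 : ℝ) < 1 - r := by linarith
  have hmaps : ∀ z ∈ ball (0 : ℂ) 1, ‖((1 - r : ℝ) : ℂ) * z‖ < 1 - r := by
    intro z hz
    rw [mem_ball, dist_zero_right] at hz
    rw [norm_mul, Complex.norm_real, Real.norm_eq_abs, abs_of_pos hs0]
    nlinarith
  have hball : ∀ z ∈ ball (0 : ℂ) 1, ((1 - r : ℝ) : ℂ) * z ∈ ball (0 : ℂ) 1 := by
    intro z hz
    rw [mem_ball, dist_zero_right]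
    linarith [hmaps z hz]
  refine ⟨?_, ?_, by simp [h.map_zero], fun z hz => ⟨(h.mapsTo (hball z hz)).1, ?_⟩⟩
  · exact h.differentiableOn.comp ((differentiable_id.const_mul _).differentiableOn) hball
  · intro z₁ hz₁ z₂ hz₂ heq
    have := h.injOn (hball z₁ hz₁) (hball z₂ hz₂) heq
    have hs : ((1 - r : ℝ) : ℂ) ≠ 0 := by exact_mod_cast hs0.ne'
    exact mul_left_cancel₀ hs this
  · rintro (hzK | hzK')
    · exact (h.mapsTo (hball z hz)).2 hzK
    · have hlt : ‖φ (((1 - r : ℝ) : ℂ) * z)‖ < 1 - r :=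
        (h.norm_le_norm (by simpa [dist_zero_right] using hball z hz)).trans_lt (hmaps z hz)
      have hdist : dist (φ (((1 - r : ℝ) : ℂ) * z)) ζ ≤ r := hK' hzK'
      rw [dist_eq_norm] at hdist
      have htri : ‖ζ‖ ≤ ‖φ (((1 - r : ℝ) : ℂ) * z)‖ + ‖φ (((1 - r : ℝ) : ℂ) * z) - ζ‖ := by
        have := norm_sub_le (φ (((1 - r : ℝ) : ℂ) * z)) (φ (((1 - r : ℝ) : ℂ) * z) - ζ)
        rwa [sub_sub_cancel] at this
      linarith

/-- Derivative at `0` of the shrunk map: `|(φ((1 - r)·))'(0)| = (1 - r)|φ'(0)|` (`r < 1`).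
[folklore] -/
theorem IsUnivalentInto.norm_deriv_comp_mul_one_sub (h : IsUnivalentInto K φ) (hr1 : r < 1) :
    ‖deriv (fun z => φ (((1 - r : ℝ) : ℂ) * z)) 0‖ = (1 - r) * ‖deriv φ 0‖ := by
  have hs0 : (0 : ℝ) < 1 - r := by linarith
  have hφ : HasDerivAt φ (deriv φ 0) (((1 - r : ℝ) : ℂ) * 0) := by
    rw [mul_zero]
    exact (h.differentiableOn.differentiableAt (ball_mem_nhds (0 : ℂ) one_pos)).hasDerivAt
  have hlin : HasDerivAt (fun z : ℂ => ((1 - r : ℝ) : ℂ) * z) ((1 - r : ℝ) : ℂ) 0 := by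
    simpa using (hasDerivAt_id (0 : ℂ)).const_mul ((1 - r : ℝ) : ℂ)
  have hcomp : HasDerivAt (fun z => φ (((1 - r : ℝ) : ℂ) * z)) (deriv φ 0 * ((1 - r : ℝ) : ℂ)) 0 :=
    hφ.comp (0 : ℂ) hlin
  rw [hcomp.deriv, norm_mul, Complex.norm_real, Real.norm_eq_abs, abs_of_pos hs0, mul_comm]

/-- **Deficit bound for one admissible map**: `(1 - r)|φ'(0)| ≤ 𝔯(K ∪ K')` for `|ζ| ≥ 1`,
`r ≥ 0`, `K' ⊆ B̄(ζ, r)`. [cite: LawlerSchrammWernerEJP2002, proof of Lemma 2.3 (p. 7)] -/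
theorem IsUnivalentInto.one_sub_mul_norm_deriv_le_conformalRadius_union (h : IsUnivalentInto K φ)
    (hζ : 1 ≤ ‖ζ‖) (hr : 0 ≤ r) (hK' : K' ⊆ closedBall ζ r) :
    (1 - r) * ‖deriv φ 0‖ ≤ conformalRadius (K ∪ K') := by
  rcases le_or_gt 1 r with hr1 | hr1
  · exact (mul_nonpos_of_nonpos_of_nonneg (by linarith) (norm_nonneg _)).trans
      (conformalRadius_nonneg _)
  rcases hr.eq_or_lt with rfl | hr0
  · -- `r = 0`: `K' ⊆ {ζ}` lies outside `𝔻`, so `φ` itself is admissible for `K ∪ K'`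
    have hadm : IsUnivalentInto (K ∪ K') φ := by
      refine ⟨h.differentiableOn, h.injOn, h.map_zero, fun z hz => ⟨(h.mapsTo hz).1, ?_⟩⟩
      rintro (hzK | hzK')
      · exact (h.mapsTo hz).2 hzK
      · have h1 : φ z = ζ := by simpa using hK' hzK'
        have h2 := (h.mapsTo hz).1
        rw [h1, mem_ball, dist_zero_right] at h2
        linarith
    simpa using hadm.norm_deriv_le_conformalRadius
  · have := (h.comp_mul_of_subset_closedBall hζ hr0 hr1 hK').norm_deriv_le_conformalRadius
    rwa [h.norm_deriv_comp_mul_one_sub hr1] at this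

/-- **The linear deficit bound**: for `|ζ| ≥ 1`, `r ≥ 0` and `K' ⊆ B̄(ζ, r)`,
`(1 - r) 𝔯(K) ≤ 𝔯(K ∪ K')` (pass to the supremum over admissible `φ`). A harmonic-measure-free
substitute, with exponent `1` in `r`, for LSW's (2.15)–(2.16)
"`min{-log 𝔯(K), 1} ≤ c₂ (diam K)²`". [cite: LawlerSchrammWernerEJP2002, proof of Lemma 2.3, (2.15)–(2.16) (p. 7)] -/
theorem one_sub_mul_conformalRadius_le_union (hζ : 1 ≤ ‖ζ‖) (hr : 0 ≤ r)
    (hK' : K' ⊆ closedBall ζ r) :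
    (1 - r) * conformalRadius K ≤ conformalRadius (K ∪ K') := by
  rcases le_or_gt 1 r with hr1 | hr1
  · exact (mul_nonpos_of_nonpos_of_nonneg (by linarith) (conformalRadius_nonneg K)).trans
      (conformalRadius_nonneg _)
  have hs0 : (0 : ℝ) < 1 - r := by linarith
  have hle : conformalRadius K ≤ conformalRadius (K ∪ K') / (1 - r) := by
    refine conformalRadius_le (div_nonneg (conformalRadius_nonneg _) hs0.le) fun φ hφ => ?_
    rw [le_div_iff₀ hs0, mul_comm]
    exact hφ.one_sub_mul_norm_deriv_le_conformalRadius_union hζ hr hK'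
  rwa [le_div_iff₀ hs0, mul_comm] at hle

/-- **Deficit bound, logarithmic form**: for `|ζ| ≥ 1`, `0 ≤ r ≤ 1/2`, `K' ⊆ B̄(ζ, r)` and
`𝔯(K) > 0`: `log 𝔯(K) - log 𝔯(K ∪ K') ≤ 2r` (`-log(1 - r) ≤ (1 - r)⁻¹ - 1 ≤ 2r`).
[cite: LawlerSchrammWernerEJP2002, proof of Lemma 2.3, (2.15)–(2.16) (p. 7)] -/
theorem log_conformalRadius_sub_log_union_le_two_mul (hζ : 1 ≤ ‖ζ‖) (hr : 0 ≤ r)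
    (hr2 : r ≤ 1 / 2) (hK' : K' ⊆ closedBall ζ r) (hpos : 0 < conformalRadius K) :
    Real.log (conformalRadius K) - Real.log (conformalRadius (K ∪ K')) ≤ 2 * r := by
  have h1r : 0 < 1 - r := by linarith
  have hratio := one_sub_mul_conformalRadius_le_union (K := K) hζ hr hK'
  have hUpos : 0 < conformalRadius (K ∪ K') := lt_of_lt_of_le (mul_pos h1r hpos) hratio
  have hlog1 : Real.log ((1 - r) * conformalRadius K) ≤ Real.log (conformalRadius (K ∪ K')) :=
    Real.log_le_log (mul_pos h1r hpos) hratio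
  rw [Real.log_mul h1r.ne' hpos.ne'] at hlog1
  have hlog2 : -Real.log (1 - r) ≤ (1 - r)⁻¹ - 1 := by
    rw [← Real.log_inv]
    exact Real.log_le_sub_one_of_pos (inv_pos.2 h1r)
  have hinv : (1 - r)⁻¹ ≤ 1 + 2 * r := by
    rw [inv_le_iff_one_le_mul₀ h1r]
    nlinarith
  linarith

/-- **Deficit bound, truncated logarithmic form**: for `|ζ| ≥ 1`, `r ≥ 0`, `K' ⊆ B̄(ζ, r)` and
`𝔯(K) > 0`: `min{log 𝔯(K) - log 𝔯(K ∪ K'), 1} ≤ 2r` (for `r > 1/2` the right side exceeds `1`).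
[cite: LawlerSchrammWernerEJP2002, proof of Lemma 2.3, (2.15)–(2.16) (p. 7)] -/
theorem min_log_conformalRadius_sub_log_union_le_two_mul (hζ : 1 ≤ ‖ζ‖) (hr : 0 ≤ r)
    (hK' : K' ⊆ closedBall ζ r) (hpos : 0 < conformalRadius K) :
    min (Real.log (conformalRadius K) - Real.log (conformalRadius (K ∪ K'))) 1 ≤ 2 * r := by
  by_cases hr2 : r ≤ 1 / 2
  · exact (min_le_left _ _).trans (log_conformalRadius_sub_log_union_le_two_mul hζ hr hr2 hK' hpos)
  · push Not at hr2
    linarith [min_le_right (Real.log (conformalRadius K) - Real.log (conformalRadius (K ∪ K'))) 1]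

/-- **The LSW shape of the linear deficit bound.** For hulls `K ⊆ K₂ ⊆ K ∪ B̄(ζ, r)` with
`|ζ| ≥ 1` and `r ≥ 0` (in LSW: `K = Q(θ)`, `K₂ = Q(2π) = Q(θ) ∪ Q'`, `Q'` within distance `r` of
the boundary point `1`): `(1 - r) 𝔯(K) ≤ 𝔯(K₂) ≤ 𝔯(K)`, and if `𝔯(K) > 0` then
`min{log 𝔯(K) - log 𝔯(K₂), 1} ≤ 2r`. [cite: LawlerSchrammWernerEJP2002, proof of Lemma 2.3, (2.15)–(2.16) (p. 7)] -/
theorem conformalRadius_deficit_of_subset_union (hζ : 1 ≤ ‖ζ‖) (hr : 0 ≤ r) (hKK₂ : K ⊆ K₂)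
    (hK₂ : K₂ ⊆ K ∪ closedBall ζ r) :
    (1 - r) * conformalRadius K ≤ conformalRadius K₂ ∧ conformalRadius K₂ ≤ conformalRadius K ∧
      (0 < conformalRadius K →
        min (Real.log (conformalRadius K) - Real.log (conformalRadius K₂)) 1 ≤ 2 * r) := by
  have hmono₁ : conformalRadius (K ∪ closedBall ζ r) ≤ conformalRadius K₂ := conformalRadius_mono hK₂
  have hmono₂ : conformalRadius K₂ ≤ conformalRadius K := conformalRadius_mono hKK₂
  have hratio := one_sub_mul_conformalRadius_le_union (K := K) hζ hr Subset.rfl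
  refine ⟨hratio.trans hmono₁, hmono₂, fun hpos => ?_⟩
  by_cases hr2 : r ≤ 1 / 2
  · have hlog := log_conformalRadius_sub_log_union_le_two_mul (K := K) hζ hr hr2 Subset.rfl hpos
    have hUpos : 0 < conformalRadius (K ∪ closedBall ζ r) :=
      lt_of_lt_of_le (mul_pos (by linarith) hpos) hratio
    have hlogmono : Real.log (conformalRadius (K ∪ closedBall ζ r)) ≤ Real.log (conformalRadius K₂) :=
      Real.log_le_log hUpos hmono₁
    refine (min_le_left _ _).trans ?_
    linarith
  · push Not at hr2
    linarith [min_le_right (Real.log (conformalRadius K) - Real.log (conformalRadius K₂)) 1]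

end Literature.Analysis.Complex
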